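import Literature.Computability.AlgebraicComplexity.FlipGraphSymmetryNormalForm
import Literature.Computability.AlgebraicComplexity.LadermanStabilizerZ2
import HarnessLib

/-!
# The stabiliser of Laderman's scheme over `ℤ₂` has exactly `24` elements (Burichenko 2015, Thm. 1.1: `Aut(L) ≅ S₄`)

Topic `Literature/Computability/AlgebraicComplexity`; completes `LadermanStabilizerZ2.lean` (the
EXISTENCE half: `24` distinct elements `LadermanZ2.stab i` of KM's symmetry group `G` fix Laderman's
scheme mod `2`) with the REVERSE inclusion: every element of `G` (the tree's `InSymmetryGroup`,
generated by the sandwiches, the cyclic shift and the transposition) fixing `LadermanZ2.scheme` has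
the same underlying linear map as one of those `24`. Sources: V. P. Burichenko, *Symmetries of matrix
multiplication algorithms. I*, arXiv:1508.01110 (2015), Theorem 1.1 ("`Aut(L) ≅ S₄`", over a field;
`Aut` inside the decomposable automorphisms incl. permutations of the factors); M. Kauers,
J. Moosbauer, arXiv:2212.01175 (KM), §2 (the group `G`); M. Heule, M. Kauers, M. Seidl, J. Symb.
Comput. 104 (2021) (HKS), §4–5 (`G = GL(K,n)³ × S₃`, "`168³ · 6`" over `ℤ₂`). Everything is PROVED
(kernel computation on `9`-bit codes of `3 × 3` matrices over `ℤ₂` + the normal form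
`FlipGraphSymmetryNormalForm.lean`); no named facts.

## The argument (ours)

By `InSymmetryGroup.exists_normalForm` an element of `G` acts as `T ↦ σ_k((P,Q,R)·T)` (`k < 6`,
`P, Q, R ∈ GL₃(ℤ₂)`). If it fixes the scheme, the image of every one of the `23` terms is again a
term (over `ℤ₂` a non-zero rank-one tensor determines its factors, `triad_factors_eq_of_two`).
One of Laderman's terms has an INVERTIBLE `A`-factor `G₀` and another an invertible `B`-factor
`H₀` (mod `2`); reading off the sandwich outputs `P G₀ Qᵀ` and `Q⁻ᵀ H₀ Rᵀ` from the images of these two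
terms determines `Q` from `P` and `R` from `Q`, and for each word `σ_k` only the two terms whose
pulled-back `A`-slot (resp. `B`-slot) is invertible can be the image (`admX`, `admY`). So the kernel
only has to examine `6 · 168 · 2 · 2 = 4032` candidates `(k, P, Q, R)` and test which of them map
all `23` terms to terms: exactly `24` tuples survive (`survivors`, `checkK_eq_true`; soundness of the
enumeration `codes_mem_survivors`, `mem_survivors`). The `24` maps they name contain the `24`
pairwise distinct maps `LadermanZ2.stab i` (which lie in `G` and fix the scheme), hence coincide
with them (pigeonhole) — `burichenko2015_laderman_stabilizer_exact`, `laderman_stabilizer_iff`.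

HONEST FRAMING: a statement about Laderman's scheme READ MOD `2` and KM's group `G` over `ℤ₂` as the
tree generates it; Burichenko's theorem is over arbitrary fields, with signs, and identifies the
group as `S₄` — the group structure is not typed here (only the count `24` and the list).

## References

* V. P. Burichenko, *Symmetries of matrix multiplication algorithms. I*, arXiv:1508.01110 (2015):
  Thm. 1.1, §§4–5. [Burichenko2015SymI]
* M. Kauers, J. Moosbauer, *Flip Graphs for Matrix Multiplication*, ISSAC 2023, arXiv:2212.01175,
  §2 (symmetry group, equivalence). [KauersMoosbauer2022FlipGraphs]
* M. J. H. Heule, M. Kauers, M. Seidl, *New ways to multiply 3 × 3-matrices*, J. Symbolic Comput.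
  104 (2021), §4–5. [HeuleKauersSeidl2021]
-/

set_option Elab.async false
set_option maxRecDepth 100000

namespace Literature.Computability.AlgebraicComplexity

open scoped BigOperators Kronecker
open Matrix FlipGraph

namespace LadermanZ2

namespace Exact

/-! ## §1 Nine-bit codes of `3 × 3` matrices over `ℤ₂` -/

/-- Bit `3 i + j` of the code = entry `(i, j)`. [folklore] -/
def bit (c : ℕ) (i j : Fin 3) : Bool := c.testBit (3 * i.val + j.val)

/-- The matrix with code `c`. [folklore] -/
def matC (c : ℕ) : Matrix (Fin 3) (Fin 3) (ZMod 2) := fun i j => if bit c i j then 1 else 0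

/-- The same matrix as a vector on the positions `Fin 3 × Fin 3` (the factor type of the tree's
rank-one tensors). [cite: KauersMoosbauer2022FlipGraphs, Def. 1] -/
def vecC (c : ℕ) : Fin 3 × Fin 3 → ZMod 2 := fun p => matC c p.1 p.2

/-- The code with the given Boolean entries. [folklore] -/
def mkC (f : Fin 3 → Fin 3 → Bool) : ℕ :=
  (if f 0 0 then 1 else 0) + (if f 0 1 then 2 else 0) + (if f 0 2 then 4 else 0) +
  (if f 1 0 then 8 else 0) + (if f 1 1 then 16 else 0) + (if f 1 2 then 32 else 0) +
  (if f 2 0 then 64 else 0) + (if f 2 1 then 128 else 0) + (if f 2 2 then 256 else 0)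

/-- `mkC` has the prescribed bits. [folklore] -/
private theorem bit_mkC : ∀ (f : Fin 3 → Fin 3 → Bool) (i j : Fin 3), bit (mkC f) i j = f i j := by
  decide

/-- `mkC` produces codes `< 512`. [folklore] -/
private theorem mkC_lt : ∀ f : Fin 3 → Fin 3 → Bool, mkC f < 512 := by decide

/-- The code of a matrix. [folklore] -/
def codeOf (M : Matrix (Fin 3) (Fin 3) (ZMod 2)) : ℕ := mkC fun i j => decide (M i j = 1)

/-- Matrices round-trip through their codes. [folklore] -/
private theorem matC_codeOf : ∀ M : Matrix (Fin 3) (Fin 3) (ZMod 2), matC (codeOf M) = M := by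
  decide

/-- Codes `< 512` round-trip through their matrices. [folklore] -/
private theorem codeOf_matC : ∀ c < 512, codeOf (matC c) = c := by decide

/-- Codes of matrices are `< 512`. [folklore] -/
private theorem codeOf_lt (M : Matrix (Fin 3) (Fin 3) (ZMod 2)) : codeOf M < 512 := mkC_lt _

/-- Matrix product on codes. [folklore] -/
def mulC (a b : ℕ) : ℕ :=
  mkC fun i j => ((bit a i 0 && bit b 0 j) ^^ (bit a i 1 && bit b 1 j)) ^^ (bit a i 2 && bit b 2 j)

/-- Transpose on codes. [folklore] -/
def trC (a : ℕ) : ℕ := mkC fun i j => bit a j i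

/-- `mulC` is the matrix product. [folklore] -/
private theorem matC_mulC (a b : ℕ) : matC (mulC a b) = matC a * matC b := by
  ext i j
  have key : ∀ (a0 a1 a2 b0 b1 b2 : Bool),
      (if ((a0 && b0) ^^ (a1 && b1)) ^^ (a2 && b2) then (1 : ZMod 2) else 0) =
        (if a0 then 1 else 0) * (if b0 then 1 else 0) + (if a1 then 1 else 0) * (if b1 then 1 else 0) +
          (if a2 then 1 else 0) * (if b2 then 1 else 0) := by decide
  simp only [matC, mulC, bit_mkC, Matrix.mul_apply, Fin.sum_univ_three]
  exact key _ _ _ _ _ _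

/-- `trC` is transposition. [folklore] -/
private theorem matC_trC (a : ℕ) : matC (trC a) = (matC a)ᵀ := by
  ext i j
  simp only [matC, trC, bit_mkC, transpose_apply]

/-- `mulC` outputs codes `< 512`. [folklore] -/
private theorem mulC_lt (a b : ℕ) : mulC a b < 512 := mkC_lt _
/-- `trC` outputs codes `< 512`. [folklore] -/
private theorem trC_lt (a : ℕ) : trC a < 512 := mkC_lt _

/-- Transposition on vectors of positions is `trC` on codes. [folklore] -/
private theorem vecC_swap (c : ℕ) : (fun p : Fin 3 × Fin 3 => vecC c p.swap) = vecC (trC c) := by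
  funext p; simp only [vecC, matC_trC, transpose_apply, Prod.fst_swap, Prod.snd_swap]

/-- The `3 × 3` determinant over `ℤ₂` on codes (Sarrus). [folklore] -/
def detB (c : ℕ) : Bool :=
  ((bit c 0 0 && ((bit c 1 1 && bit c 2 2) ^^ (bit c 1 2 && bit c 2 1))) ^^
    (bit c 0 1 && ((bit c 1 0 && bit c 2 2) ^^ (bit c 1 2 && bit c 2 0)))) ^^
    (bit c 0 2 && ((bit c 1 0 && bit c 2 1) ^^ (bit c 1 1 && bit c 2 0)))

/-- `detB` decides invertibility: a matrix with unit determinant has `detB (codeOf M) = true`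
(all `512` matrices, via the explicit `3 × 3` determinant formula). [folklore] -/
private theorem detB_codeOf_of_isUnit (M : Matrix (Fin 3) (Fin 3) (ZMod 2)) (h : IsUnit M.det) :
    detB (codeOf M) = true := by
  have key : ∀ M : Matrix (Fin 3) (Fin 3) (ZMod 2),
      M 0 0 * M 1 1 * M 2 2 - M 0 0 * M 1 2 * M 2 1 - M 0 1 * M 1 0 * M 2 2 + M 0 1 * M 1 2 * M 2 0 +
        M 0 2 * M 1 0 * M 2 1 - M 0 2 * M 1 1 * M 2 0 = 0 ∨ detB (codeOf M) = true := by
    decide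
  rcases key M with h0 | h1
  · rw [← Matrix.det_fin_three] at h0
    rw [h0] at h; exact absurd h not_isUnit_zero
  · exact h1

/-- The codes of `GL₃(ℤ₂)` (the `168` invertible `3 × 3` matrices over `ℤ₂`, increasing).
[cite: HeuleKauersSeidl2021, §5 ("`168³ · 6`")] -/
def gl : List ℕ :=
  [84, 85, 86, 87, 92, 93, 94, 95, 98, 99, 102, 103, 106, 107, 110, 111, 114, 115, 116, 117, 122, 123, 124, 125, 140, 141, 142, 143, 156, 157, 158, 159, 161, 163, 165, 167, 169, 171, 172, 174, 177, 179, 181, 183, 185, 187, 188, 190, 204, 205, 206, 207, 212, 213, 214, 215, 225, 226, 229, 230, 233, 234, 236, 239, 241, 242, 244, 247, 249, 250, 253, 254, 266, 267, 270, 271, 273, 275, 277, 279, 281, 282, 285, 286, 298, 299, 302, 303, 305, 307, 309, 311, 313, 314, 317, 318, 330, 331, 334, 335, 337, 339, 340, 342, 345, 346, 348, 351, 354, 355, 358, 359, 369, 370, 372, 375, 377, 379, 380, 382, 394, 395, 396, 397, 401, 403, 405, 407, 409, 410, 412, 415, 417, 419, 421, 423, 425, 426, 428, 431, 442, 443, 444,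 445, 458, 459, 460, 461, 465, 467, 468, 470, 473, 474, 477, 478, 481, 482, 485, 486, 489, 491, 492, 494, 498, 499, 500, 501]

/-- The codes of their inverses, aligned with `gl`. [folklore] -/
def glInvList : List ℕ :=
  [84, 340, 212, 468, 116, 372, 500, 244, 140, 172, 156, 188, 396, 428, 444, 412, 204, 492, 92, 380, 460, 236, 124, 348, 98, 226, 354, 482, 102, 486, 358, 230, 161, 165, 163, 167, 225, 485, 99, 359, 417, 421, 423, 419, 481, 229, 103, 355, 114, 242, 498, 370, 86, 470, 214, 342, 169, 141, 187, 159, 233, 461, 123, 351, 489, 205, 95, 379, 425, 397, 415, 443, 266, 282, 298, 314, 273, 275, 277, 279, 281, 267, 317, 303, 270, 318, 302, 286, 305, 311, 309, 307, 313, 271, 285, 299, 394, 410, 442, 426, 337, 467, 85, 215, 345, 459, 125, 239, 142, 190, 158, 174, 377, 207, 93, 491, 369, 247, 117, 499, 330, 474, 106, 250, 401, 403, 407, 405, 473, 331, 111, 253, 177, 183, 179, 181, 249, 335, 107, 477, 334, 254, 110, 478, 458, 346, 122, 234, 465, 339, 87, 213, 409, 395, 431, 445, 185, 143, 171, 157,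 241, 375, 115, 501, 206, 382, 94, 494]

/-- The inverse code (look-up; junk off `gl`). [folklore] -/
def invC (c : ℕ) : ℕ := glInvList.getD (gl.idxOf c) 0

/-- `gl` lists exactly the codes with `detB`. [cite: HeuleKauersSeidl2021, §5] -/
private theorem mem_gl_iff_detB : ∀ c : Fin 512, (c.val ∈ gl) ↔ detB c.val = true := by decide

/-- `gl` has `168` entries (`|GL₃(ℤ₂)| = 168`). [cite: HeuleKauersSeidl2021, §5] -/
theorem gl_length : gl.length = 168 := by decide

/-- The inverse table is correct: `c · invC c = 1` (code `273`). [folklore] -/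
private theorem mulC_invC : ∀ c ∈ gl, mulC c (invC c) = 273 := by decide

/-- The identity matrix has code `273`. [folklore] -/
private theorem matC_273 : matC 273 = 1 := by decide

/-- For `c ∈ gl`: `(matC c)⁻¹ = matC (invC c)`. [folklore] -/
private theorem matC_inv {c : ℕ} (hc : c ∈ gl) : (matC c)⁻¹ = matC (invC c) :=
  Matrix.inv_eq_right_inv (by rw [← matC_mulC, mulC_invC c hc, matC_273])

/-- For `c ∈ gl`: `matC c` is invertible. [folklore] -/
private theorem isUnit_det_matC {c : ℕ} (hc : c ∈ gl) : IsUnit (matC c).det :=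
  Matrix.isUnit_det_of_right_inverse (by rw [← matC_mulC, mulC_invC c hc, matC_273])

/-- An invertible matrix has its code in `gl`. [folklore] -/
private theorem codeOf_mem_gl {M : Matrix (Fin 3) (Fin 3) (ZMod 2)} (h : IsUnit M.det) : codeOf M ∈ gl :=
  (mem_gl_iff_detB ⟨codeOf M, codeOf_lt M⟩).mpr (detB_codeOf_of_isUnit M h)

/-- Left inverses on codes: `invC c · c = 1`. [folklore] -/
private theorem mulC_invC_left : ∀ c ∈ gl, mulC (invC c) c = 273 := by decide

/-- `cᵀ · (c⁻¹)ᵀ = 1` on codes. [folklore] -/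
private theorem mulC_trC_trC_invC : ∀ c ∈ gl, mulC (trC c) (trC (invC c)) = 273 := by decide

/-- The adjugate on codes (cyclic `2 × 2` cofactors; over `ℤ₂` it is the inverse on `GL₃(ℤ₂)`).
[folklore] -/
def adjC (c : ℕ) : ℕ :=
  mkC fun i j => (bit c (j + 1) (i + 1) && bit c (j + 2) (i + 2)) ^^ (bit c (j + 1) (i + 2) && bit c (j + 2) (i + 1))

/-- On `GL₃(ℤ₂)` the adjugate is the tabulated inverse. [folklore] -/
private theorem adjC_eq_invC : ∀ c ∈ gl, adjC c = invC c := by decide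

/-- Members of `gl` are codes `< 512`. [folklore] -/
private theorem lt_of_mem_gl : ∀ c ∈ gl, c < 512 := by decide

/-- Members of `gl` have `detB = true`. [folklore] -/
private theorem detB_of_mem_gl {c : ℕ} (hc : c ∈ gl) : detB c = true :=
  (mem_gl_iff_detB ⟨c, lt_of_mem_gl c hc⟩).mp hc

/-- A code `< 512` with invertible matrix is in `gl`. [folklore] -/
private theorem mem_gl_of_isUnit {c : ℕ} (hc : c < 512) (h : IsUnit (matC c).det) : c ∈ gl := by
  have h' := codeOf_mem_gl h
  rwa [codeOf_matC c hc] at h'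

/-- `gl` is closed under products. [folklore] -/
private theorem mulC_mem_gl {a b : ℕ} (ha : a ∈ gl) (hb : b ∈ gl) : mulC a b ∈ gl :=
  mem_gl_of_isUnit (mulC_lt a b)
    (by rw [matC_mulC, det_mul]; exact (isUnit_det_matC ha).mul (isUnit_det_matC hb))

/-- `gl` is closed under transposition. [folklore] -/
private theorem trC_mem_gl {a : ℕ} (ha : a ∈ gl) : trC a ∈ gl :=
  mem_gl_of_isUnit (trC_lt a) (by rw [matC_trC, det_transpose]; exact isUnit_det_matC ha)

/-- `gl` is closed under inversion. [folklore] -/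
private theorem invC_mem_gl : ∀ c ∈ gl, invC c ∈ gl := by decide

/-- `matC` is injective on codes `< 512`. [folklore] -/
private theorem eq_of_matC_eq {a b : ℕ} (ha : a < 512) (hb : b < 512) (h : matC a = matC b) : a = b := by
  rw [← codeOf_matC a ha, ← codeOf_matC b hb, h]

/-! ## §2 The action on code triples -/

/-- A code triple `(Z, X, Y)` (tree slots: output pattern, `A`-form, `B`-form).
[cite: KauersMoosbauer2022FlipGraphs, Def. 1] -/
abbrev Tri : Type := ℕ × ℕ × ℕ

/-- The rank-one tensor presented by a code triple. [cite: KauersMoosbauer2022FlipGraphs, Def. 1] -/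
def tr3 (t : Tri) : Tn (ZMod 2) 3 := triad (vecC t.1) (vecC t.2.1) (vecC t.2.2)

/-- `X ↦ A X Bᵀ` on codes (`(matC a ⊗ₖ matC b)·vecC x`). [cite: HeuleKauersSeidl2021, §4] -/
def axbT (a b x : ℕ) : ℕ := mulC (mulC a x) (trC b)

/-- **The Kronecker action on a factor is `X ↦ A X Bᵀ`.** [cite: HeuleKauersSeidl2021, §4 ("`UAV⁻¹`")] -/
private theorem kron_mulVec_vec (A B M : Matrix (Fin 3) (Fin 3) (ZMod 2)) :
    (A ⊗ₖ B).mulVec (fun p : Fin 3 × Fin 3 => M p.1 p.2) = fun p => (A * M * Bᵀ) p.1 p.2 := by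
  funext p
  simp only [mulVec, dotProduct, Fintype.sum_prod_type, kroneckerMap_apply, Matrix.mul_apply,
    transpose_apply, Finset.sum_mul]
  rw [Finset.sum_comm]
  exact Finset.sum_congr rfl fun i _ => Finset.sum_congr rfl fun j _ => by ring

/-- On codes: `(matC a ⊗ₖ matC b)·vecC x = vecC (axbT a b x)`. [cite: HeuleKauersSeidl2021, §4] -/
private theorem kron_mulVec_vecC (a b x : ℕ) :
    (matC a ⊗ₖ matC b).mulVec (vecC x) = vecC (axbT a b x) := by
  have h := kron_mulVec_vec (matC a) (matC b) (matC x)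
  have e : (fun p : Fin 3 × Fin 3 => matC x p.1 p.2) = vecC x := rfl
  rw [e] at h
  rw [h]
  funext p
  simp only [vecC, axbT, matC_mulC, matC_trC]

/-- The sandwich `(P, Q, R)` on code triples: `Z ↦ P⁻ᵀZR⁻¹`, `X ↦ PXQᵀ`, `Y ↦ Q⁻ᵀYRᵀ`.
[cite: KauersMoosbauer2022FlipGraphs, §2 (symmetry group)] -/
def sandC (p q r : ℕ) (t : Tri) : Tri :=
  (axbT (trC (invC p)) (trC (invC r)) t.1, axbT p q t.2.1, axbT (trC (invC q)) r t.2.2)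

/-- **The sandwich acts on presented tensors by `sandC`** (for codes in `GL₃(ℤ₂)`).
[cite: KauersMoosbauer2022FlipGraphs, §2 (symmetry group)] -/
theorem swAct_tr3 {p q r : ℕ} (hp : p ∈ gl) (hq : q ∈ gl) (hr : r ∈ gl) (t : Tri) :
    swAct (matC p) (matC q) (matC r) (tr3 t) = tr3 (sandC p q r t) := by
  rw [swAct, tr3, actTensor_triad, matC_inv hp, matC_inv hq, matC_inv hr, ← matC_trC, ← matC_trC,
    ← matC_trC, kron_mulVec_vecC, kron_mulVec_vecC, kron_mulVec_vecC]
  rfl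

/-- The transposition `τ` on code triples. [cite: KauersMoosbauer2022FlipGraphs, §2] -/
def tauC (t : Tri) : Tri := (trC t.1, trC t.2.2, trC t.2.1)
/-- The cyclic shift `ρ` on code triples. [cite: KauersMoosbauer2022FlipGraphs, §2] -/
def rhoC (t : Tri) : Tri := (trC t.2.1, t.2.2, trC t.1)

/-- `τ` on presented tensors. [cite: KauersMoosbauer2022FlipGraphs, §2] -/
private theorem transposeMap_tr3 (t : Tri) : transposeMap 3 (tr3 t) = tr3 (tauC t) := by
  rw [tr3, transposeMap_triad, tr3, tauC, vecC_swap, vecC_swap, vecC_swap]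
/-- `ρ` on presented tensors. [cite: KauersMoosbauer2022FlipGraphs, §2] -/
private theorem cycleMap_tr3 (t : Tri) : cycleMap 3 (tr3 t) = tr3 (rhoC t) := by
  rw [tr3, cycleMap_triad, tr3, rhoC, vecC_swap, vecC_swap]

/-- The six words on code triples (matching `permMap`). [cite: HeuleKauersSeidl2021, §4] -/
def permC (k : ℕ) (t : Tri) : Tri :=
  match k with
  | 0 => t | 1 => tauC t | 2 => rhoC t | 3 => tauC (rhoC t) | 4 => rhoC (rhoC t)
  | 5 => tauC (rhoC (rhoC t)) | _ => t

/-- The words act on presented tensors by `permC`. [cite: HeuleKauersSeidl2021, §4] -/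
theorem permMap_tr3 (k : ℕ) (t : Tri) : permMap 3 k (tr3 t) = tr3 (permC k t) := by
  rcases k with _ | _ | _ | _ | _ | _ | _
  · rfl
  · exact transposeMap_tr3 t
  · exact cycleMap_tr3 t
  · show transposeMap 3 (cycleMap 3 (tr3 t)) = _
    rw [cycleMap_tr3, transposeMap_tr3]; rfl
  · show cycleMap 3 (cycleMap 3 (tr3 t)) = _
    rw [cycleMap_tr3, cycleMap_tr3]; rfl
  · show transposeMap 3 (cycleMap 3 (cycleMap 3 (tr3 t))) = _
    rw [cycleMap_tr3, cycleMap_tr3, transposeMap_tr3]; rfl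
  · rfl

/-- The index of the inverse word. [folklore] -/
def invK : ℕ → ℕ
  | 0 => 0 | 1 => 1 | 2 => 4 | 3 => 3 | 4 => 2 | 5 => 5 | _ => 0

/-- All three codes `< 512` (plumbing predicate). [folklore] -/
private def Bd (t : Tri) : Prop := t.1 < 512 ∧ t.2.1 < 512 ∧ t.2.2 < 512

/-- `trC (trC c) = c` for codes `< 512`. [folklore] -/
private theorem trC_trC : ∀ c < 512, trC (trC c) = c := by decide

/-- The inverse word undoes the word on bounded code triples. [folklore] -/
private theorem permC_invK_permC (k : ℕ) (hk : k < 6) (t : Tri) (ht : Bd t) :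
    permC (invK k) (permC k t) = t := by
  obtain ⟨z, x, y⟩ := t
  obtain ⟨hz, hx, hy⟩ := ht
  simp only at hz hx hy
  interval_cases k <;>
    simp only [permC, invK, tauC, rhoC, trC_trC _ hz, trC_trC _ hx, trC_trC _ hy]

/-- **The normal form `σ_k ∘ (P,Q,R)` on code triples.** [cite: HeuleKauersSeidl2021, §4] -/
def actC (k p q r : ℕ) (t : Tri) : Tri := permC k (sandC p q r t)

/-- `sandC` outputs are bounded. [folklore] -/
private theorem bd_sandC (p q r : ℕ) (t : Tri) : Bd (sandC p q r t) :=
  ⟨mulC_lt _ _, mulC_lt _ _, mulC_lt _ _⟩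

/-- `tauC`, `rhoC`, `permC` keep boundedness. [folklore] -/
private theorem bd_permC (k : ℕ) {t : Tri} (ht : Bd t) : Bd (permC k t) := by
  have hτ : ∀ {u : Tri}, Bd u → Bd (tauC u) := fun hu => ⟨trC_lt _, trC_lt _, trC_lt _⟩
  have hρ : ∀ {u : Tri}, Bd u → Bd (rhoC u) := fun hu => ⟨trC_lt _, hu.2.2, trC_lt _⟩
  rcases k with _ | _ | _ | _ | _ | _ | _
  · exact ht
  · exact hτ ht
  · exact hρ ht
  · exact hτ (hρ ht)
  · exact hρ (hρ ht)
  · exact hτ (hρ (hρ ht))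
  · exact ht

/-- **The normal form acts on presented tensors by `actC`.** [cite: HeuleKauersSeidl2021, §4] -/
theorem nf_tr3 (k : ℕ) {p q r : ℕ} (hp : p ∈ gl) (hq : q ∈ gl) (hr : r ∈ gl) (t : Tri) :
    permMap 3 k (swAct (matC p) (matC q) (matC r) (tr3 t)) = tr3 (actC k p q r t) := by
  rw [swAct_tr3 hp hq hr, permMap_tr3]; rfl

/-! ## §3 Laderman's terms as code triples -/

/-- The code triples `(Z, X, Y)` of Laderman's `23` terms mod `2` (tree order of `LadermanIndex`).
[cite: Laderman1976, p. 127] -/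
def Lc : List Tri :=
  [(2, 415, 16), (24, 9, 18), (8, 16, 379), (26, 25, 19), (18, 24, 3), (351, 1, 1), (324, 193, 37), (320, 65, 36), (260, 192, 5), (4, 247, 32), (64, 128, 253), (194, 388, 208), (192, 260, 144), (239, 4, 64), (130, 384, 192), (44, 52, 352), (40, 36, 288), (36, 48, 320), (1, 2, 8), (16, 32, 128), (32, 8, 4), (128, 64, 2), (256, 256, 256)]

/-- A factor as a `3 × 3` matrix (uncurrying). [folklore] -/
def mOf (f : Fin 3 × Fin 3 → ZMod 2) : Matrix (Fin 3) (Fin 3) (ZMod 2) := Matrix.of fun i j => f (i, j)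

/-- The code triple of Laderman's term `s`. [cite: Laderman1976, p. 127] -/
def cs (s : LadermanIndex) : Tri := (codeOf (mOf (W s)), codeOf (mOf (U s)), codeOf (mOf (V s)))

/-- Decoding the code of a factor gives the factor back. [folklore] -/
private theorem vecC_codeOf_mOf (f : Fin 3 × Fin 3 → ZMod 2) : vecC (codeOf (mOf f)) = f := by
  funext p; simp only [vecC, matC_codeOf]; rfl

/-- Laderman's term `s` is presented by its code triple. [cite: Laderman1976, p. 127] -/
theorem tr3_cs (s : LadermanIndex) : tr3 (cs s) = triad (W s) (U s) (V s) := by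
  rw [tr3, cs, vecC_codeOf_mOf, vecC_codeOf_mOf, vecC_codeOf_mOf]

/-- Every term's code triple is listed in `Lc` (kernel evaluation). [cite: Laderman1976, p. 127] -/
private theorem cs_mem_Lc : ∀ s : LadermanIndex, cs s ∈ Lc := by decide

/-- The term indexed `Sum.inl 0` has code triple `(2, 415, 16)`; its `A`-factor `G₀` (code `415`)
is invertible, with inverse code `253`. [cite: Laderman1976, p. 127] -/
private theorem cs_inl0 : cs (Sum.inl 0) = (2, 415, 16) := by decide
/-- The term indexed `Sum.inl 2` has code triple `(8, 16, 379)`; its `B`-factor `H₀` (code `379`)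
is invertible, with inverse code `247`. [cite: Laderman1976, p. 127] -/
private theorem cs_inl2 : cs (Sum.inl 2) = (8, 16, 379) := by decide
/-- `G₀⁻¹ G₀ = 1` on codes. [folklore] -/
private theorem g0inv_mul : mulC 253 415 = 273 := by decide
/-- `H₀⁻¹ H₀ = 1` on codes. [folklore] -/
private theorem h0inv_mul : mulC 247 379 = 273 := by decide

/-! ## §4 The candidate enumeration and its kernel replay -/

/-- The terms that can be the image of the term `Sum.inl 0` under a normal form with word `k`: those
whose pull-back by the word has an invertible `A`-slot (two per word; `mem_admX`). [folklore] -/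
def admX : ℕ → List Tri
  | 0 => [(2, 415, 16), (4, 247, 32)]
  | 1 => [(8, 16, 379), (64, 128, 253)]
  | 2 => [(351, 1, 1), (239, 4, 64)]
  | 3 => [(351, 1, 1), (239, 4, 64)]
  | 4 => [(8, 16, 379), (64, 128, 253)]
  | 5 => [(2, 415, 16), (4, 247, 32)]
  | _ => []

/-- The terms that can be the image of the term `Sum.inl 2` under a normal form with word `k`
(invertible `B`-slot of the pull-back; `mem_admY`). [folklore] -/
def admY : ℕ → List Tri
  | 0 => [(8, 16, 379), (64, 128, 253)]
  | 1 => [(2, 415, 16), (4, 247, 32)]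
  | 2 => [(2, 415, 16), (4, 247, 32)]
  | 3 => [(8, 16, 379), (64, 128, 253)]
  | 4 => [(351, 1, 1), (239, 4, 64)]
  | 5 => [(351, 1, 1), (239, 4, 64)]
  | _ => []

/-- `admX k` lists every term whose pulled-back `A`-slot is invertible. [folklore] -/
private theorem mem_admX :
    ∀ k < 6, ∀ tj ∈ Lc, detB (permC (invK k) tj).2.1 = true → tj ∈ admX k := by decide

/-- `admY k` lists every term whose pulled-back `B`-slot is invertible. [folklore] -/
private theorem mem_admY :
    ∀ k < 6, ∀ tj ∈ Lc, detB (permC (invK k) tj).2.2 = true → tj ∈ admY k := by decide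

/-- Candidate for `Q` from `P` and the image `tj` of the term `Sum.inl 0`: `Qᵀ = G₀⁻¹ P⁻¹ M`, `M` the
pulled-back `A`-slot of `tj`. [cite: Burichenko2015SymI, Thm. 1.1 (our enumeration)] -/
def candQ (k p : ℕ) (tj : Tri) : ℕ := trC (mulC (mulC 253 (adjC p)) (permC (invK k) tj).2.1)

/-- Candidate for `R` from `Q` and the image `tj` of the term `Sum.inl 2`: `Rᵀ = H₀⁻¹ Qᵀ M'`, `M'`
the pulled-back `B`-slot of `tj`. [cite: Burichenko2015SymI, Thm. 1.1 (our enumeration)] -/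
def candR (k q : ℕ) (tj : Tri) : ℕ := trC (mulC (mulC 247 (trC q)) (permC (invK k) tj).2.2)

/-- The sandwich on code triples with adjugates for inverses (what the kernel evaluates; equal to
`sandC` on `GL₃(ℤ₂)`, `actA_eq_actC`). [cite: KauersMoosbauer2022FlipGraphs, §2 (symmetry group)] -/
def sandA (p q r : ℕ) (t : Tri) : Tri :=
  (axbT (trC (adjC p)) (trC (adjC r)) t.1, axbT p q t.2.1, axbT (trC (adjC q)) r t.2.2)

/-- The normal form on code triples, adjugate version. [cite: HeuleKauersSeidl2021, §4] -/
def actA (k p q r : ℕ) (t : Tri) : Tri := permC k (sandA p q r t)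

/-- On `GL₃(ℤ₂)` the adjugate version is the action. [folklore] -/
private theorem actA_eq_actC {p q r : ℕ} (hp : p ∈ gl) (hq : q ∈ gl) (hr : r ∈ gl) (k : ℕ) (t : Tri) :
    actA k p q r t = actC k p q r t := by
  rw [actA, actC, sandA, sandC, adjC_eq_invC p hp, adjC_eq_invC q hq, adjC_eq_invC r hr]

/-- The `24` surviving normal forms `(k, P, Q, R)` (codes), found by our search and replayed by the
kernel below (`checkK_eq_true`). [cite: Burichenko2015SymI, Thm. 1.1 (`|Aut(L)| = |S₄| = 24`)] -/
def survivors : List (ℕ × ℕ × ℕ × ℕ) :=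
  [(0, 161, 84, 273), (0, 161, 273, 161), (0, 273, 84, 161), (0, 273, 273, 273), (1, 161, 84, 273), (1, 161, 273, 161), (1, 273, 84, 161), (1, 273, 273, 273), (2, 161, 98, 266), (2, 161, 266, 140), (2, 273, 98, 140), (2, 273, 266, 266), (3, 161, 98, 266), (3, 161, 266, 140), (3, 273, 98, 140), (3, 273, 266, 266), (4, 140, 98, 273), (4, 140, 266, 161), (4, 266, 98, 161), (4, 266, 266, 273), (5, 140, 98, 273), (5, 140, 266, 161), (5, 266, 98, 161), (5, 266, 266, 273)]

/-- The test of one candidate `(k, P, Q, R)`: if it maps all `23` terms to terms then it is one of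
the `24` survivors. [cite: Burichenko2015SymI, Thm. 1.1] -/
def testQR (k p q r : ℕ) : Bool :=
  !(Lc.all fun t => Lc.elem (actA k p q r t)) || survivors.elem (k, p, q, r)

/-- **The check for the word `k`:** every `P ∈ GL₃(ℤ₂)` and every pair of admissible image terms
give a candidate `(k, P, Q, R)` passing `testQR`. [cite: Burichenko2015SymI, Thm. 1.1] -/
def checkK (k : ℕ) : Bool :=
  gl.all fun p => (admX k).all fun tj => (admY k).all fun tj' =>
    testQR k p (candQ k p tj) (candR k (candQ k p tj) tj')

set_option maxHeartbeats 4000000 in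
/-- Kernel replay, word `0` (`168 · 4` candidates). [cite: Burichenko2015SymI, Thm. 1.1] -/
theorem checkK_0 : checkK 0 = true := by decide +kernel
set_option maxHeartbeats 4000000 in
/-- Kernel replay, word `1`. [cite: Burichenko2015SymI, Thm. 1.1] -/
theorem checkK_1 : checkK 1 = true := by decide +kernel
set_option maxHeartbeats 4000000 in
/-- Kernel replay, word `2`. [cite: Burichenko2015SymI, Thm. 1.1] -/
theorem checkK_2 : checkK 2 = true := by decide +kernel
set_option maxHeartbeats 4000000 in
/-- Kernel replay, word `3`. [cite: Burichenko2015SymI, Thm. 1.1] -/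
theorem checkK_3 : checkK 3 = true := by decide +kernel
set_option maxHeartbeats 4000000 in
/-- Kernel replay, word `4`. [cite: Burichenko2015SymI, Thm. 1.1] -/
theorem checkK_4 : checkK 4 = true := by decide +kernel
set_option maxHeartbeats 4000000 in
/-- Kernel replay, word `5`. [cite: Burichenko2015SymI, Thm. 1.1] -/
theorem checkK_5 : checkK 5 = true := by decide +kernel

/-- Kernel replay, all six words. [cite: Burichenko2015SymI, Thm. 1.1] -/
theorem checkK_eq_true : ∀ k < 6, checkK k = true := by
  intro k hk
  interval_cases k
  exacts [checkK_0, checkK_1, checkK_2, checkK_3, checkK_4, checkK_5]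

/-! ## §5 Soundness of the enumeration -/

/-- `G₀ ∈ GL₃(ℤ₂)` (code `415`). [folklore] -/
private theorem g0_mem : 415 ∈ gl := by decide
/-- `H₀ ∈ GL₃(ℤ₂)` (code `379`). [folklore] -/
private theorem h0_mem : 379 ∈ gl := by decide

/-- Solving for `Q`: `(G₀⁻¹ P⁻¹ (P G₀ Qᵀ))ᵀ = Q`. [folklore] -/
private theorem candQ_sound {p q : ℕ} (hp : p ∈ gl) (hq : q < 512) :
    trC (mulC (mulC 253 (adjC p)) (mulC (mulC p 415) (trC q))) = q := by
  apply eq_of_matC_eq (trC_lt _) hq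
  have h1 : matC 253 * matC 415 = 1 := by rw [← matC_mulC, g0inv_mul, matC_273]
  have h2 : matC (invC p) * matC p = 1 := by rw [← matC_mulC, mulC_invC_left p hp, matC_273]
  rw [adjC_eq_invC p hp]
  simp only [matC_trC, matC_mulC, ← Matrix.mul_assoc]
  rw [Matrix.mul_assoc (matC 253), h2, Matrix.mul_one, h1, Matrix.one_mul, transpose_transpose]

/-- Solving for `R`: `(H₀⁻¹ Qᵀ (Q⁻ᵀ H₀ Rᵀ))ᵀ = R`. [folklore] -/
private theorem candR_sound {q r : ℕ} (hq : q ∈ gl) (hr : r < 512) :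
    trC (mulC (mulC 247 (trC q)) (mulC (mulC (trC (invC q)) 379) (trC r))) = r := by
  apply eq_of_matC_eq (trC_lt _) hr
  have h1 : matC 247 * matC 379 = 1 := by rw [← matC_mulC, h0inv_mul, matC_273]
  have h2 : (matC q)ᵀ * (matC (invC q))ᵀ = 1 := by
    rw [← matC_trC, ← matC_trC, ← matC_mulC, mulC_trC_trC_invC q hq, matC_273]
  simp only [matC_trC, matC_mulC, ← Matrix.mul_assoc]
  rw [Matrix.mul_assoc (matC 247), h2, Matrix.mul_one, h1, Matrix.one_mul, transpose_transpose]

/-- `ℤ₂ = {0, 1}`. [folklore] -/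
private theorem zmod2_eq : ∀ x : ZMod 2, x = 0 ∨ x = 1 := by decide

/-- Equal vectors of positions have equal matrices. [folklore] -/
private theorem matC_eq_of_vecC_eq {a b : ℕ} (h : vecC a = vecC b) : matC a = matC b := by
  ext i j
  exact congrFun h (i, j)

/-- **Over `ℤ₂` a presented non-zero rank-one tensor determines its (bounded) code triple.**
[cite: KauersMoosbauer2022FlipGraphs, Def. 1 and Def. 4 (ground field `ℤ₂` in §4)] -/
theorem tr3_injective {t u : Tri} (ht : Bd t) (hu : Bd u) (h : tr3 t = tr3 u) (h0 : tr3 u ≠ 0) :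
    t = u := by
  have h0' : tr3 t ≠ 0 := fun e => h0 (h ▸ e)
  obtain ⟨e1, e2, e3⟩ := triad_factors_eq_of_two zmod2_eq h h0'
  obtain ⟨z, x, y⟩ := t
  obtain ⟨z', x', y'⟩ := u
  obtain ⟨hz, hx, hy⟩ := ht
  obtain ⟨hz', hx', hy'⟩ := hu
  simp only [Prod.mk.injEq]
  exact ⟨eq_of_matC_eq hz hz' (matC_eq_of_vecC_eq e1), eq_of_matC_eq hx hx' (matC_eq_of_vecC_eq e2),
    eq_of_matC_eq hy hy' (matC_eq_of_vecC_eq e3)⟩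

/-- Code triples of terms are bounded. [folklore] -/
private theorem bd_cs (s : LadermanIndex) : Bd (cs s) := ⟨codeOf_lt _, codeOf_lt _, codeOf_lt _⟩

/-- Every listed code triple is a term's. [cite: Laderman1976, p. 127] -/
private theorem exists_cs_of_mem_Lc : ∀ t ∈ Lc, ∃ s : LadermanIndex, cs s = t := by decide

/-- **A symmetry fixing the scheme maps every term to a term.**
[cite: KauersMoosbauer2022FlipGraphs, §2 (symmetry group: "maps a correct scheme to another one")] -/
theorem exists_image_term {φ : Symmetry (matMulTensor (ZMod 2) 3 3 3)} (hfix : scheme.map φ = scheme)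
    (s : LadermanIndex) : ∃ s', φ.toLinearEquiv (triad (W s) (U s) (V s)) = triad (W s') (U s') (V s') := by
  have hmem : φ.toLinearEquiv (triad (W s) (U s) (V s)) ∈ (scheme.map φ).elts := by
    rw [Scheme.map_elts, scheme_elts]
    exact Multiset.mem_map_of_mem _ (mem_fam.mpr ⟨s, rfl⟩)
  rw [hfix, scheme_elts] at hmem
  exact mem_fam.mp hmem

/-- **Soundness of the enumeration on codes:** a normal form `(k, P, Q, R)` over `GL₃(ℤ₂)` mapping
every term's code triple to a term's code triple is one of the `24` survivors.
[cite: Burichenko2015SymI, Thm. 1.1] -/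
theorem codes_mem_survivors {k p q r : ℕ} (hk : k < 6) (hp : p ∈ gl) (hq : q ∈ gl) (hr : r ∈ gl)
    (himg : ∀ s : LadermanIndex, ∃ s', actC k p q r (cs s) = cs s') : (k, p, q, r) ∈ survivors := by
  -- every listed triple goes to a listed triple
  have hall : ∀ t ∈ Lc, actC k p q r t ∈ Lc := by
    intro t ht
    obtain ⟨s, rfl⟩ := exists_cs_of_mem_Lc t ht
    obtain ⟨s', e⟩ := himg s
    rw [e]
    exact cs_mem_Lc s'
  -- the image of the term with the invertible `A`-factor determines `Q`
  obtain ⟨s₀, e₀⟩ := himg (Sum.inl 0)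
  rw [cs_inl0] at e₀
  have hsw₀ : sandC p q r (2, 415, 16) = permC (invK k) (cs s₀) := by
    have e := congrArg (permC (invK k)) e₀
    rwa [actC, permC_invK_permC k hk _ (bd_sandC _ _ _ _)] at e
  have hX : (permC (invK k) (cs s₀)).2.1 = mulC (mulC p 415) (trC q) := by rw [← hsw₀]; rfl
  have hadmX : cs s₀ ∈ admX k := mem_admX k hk _ (cs_mem_Lc _)
    (by rw [hX]; exact detB_of_mem_gl (mulC_mem_gl (mulC_mem_gl hp g0_mem) (trC_mem_gl hq)))
  have hcq : candQ k p (cs s₀) = q := by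
    rw [candQ, hX]
    exact candQ_sound hp (lt_of_mem_gl q hq)
  -- the image of the term with the invertible `B`-factor determines `R`
  obtain ⟨s₁, e₁⟩ := himg (Sum.inl 2)
  rw [cs_inl2] at e₁
  have hsw₁ : sandC p q r (8, 16, 379) = permC (invK k) (cs s₁) := by
    have e := congrArg (permC (invK k)) e₁
    rwa [actC, permC_invK_permC k hk _ (bd_sandC _ _ _ _)] at e
  have hY : (permC (invK k) (cs s₁)).2.2 = mulC (mulC (trC (invC q)) 379) (trC r) := by
    rw [← hsw₁]; rfl
  have hadmY : cs s₁ ∈ admY k := mem_admY k hk _ (cs_mem_Lc _)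
    (by rw [hY]; exact detB_of_mem_gl
          (mulC_mem_gl (mulC_mem_gl (trC_mem_gl (invC_mem_gl q hq)) h0_mem) (trC_mem_gl hr)))
  have hcr : candR k q (cs s₁) = r := by
    rw [candR, hY]
    exact candR_sound hq (lt_of_mem_gl r hr)
  -- read the verdict off the kernel check
  have hK := checkK_eq_true k hk
  rw [checkK, List.all_eq_true] at hK
  have h1 := hK p hp
  rw [List.all_eq_true] at h1
  have h2 := h1 _ hadmX
  rw [List.all_eq_true] at h2
  have h3 := h2 _ hadmY
  rw [hcq, hcr, testQR] at h3
  have hfix' : (Lc.all fun t => Lc.elem (actA k p q r t)) = true :=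
    List.all_eq_true.mpr fun t ht =>
      List.elem_eq_true_of_mem (by rw [actA_eq_actC hp hq hr]; exact hall t ht)
  rw [hfix'] at h3
  exact List.mem_of_elem_eq_true h3

/-- **Every element of `G` fixing Laderman's scheme mod `2` is, as a map, one of the `24` surviving
normal forms.** [cite: Burichenko2015SymI, Thm. 1.1] -/
theorem mem_survivors {φ : Symmetry (matMulTensor (ZMod 2) 3 3 3)} (hφ : InSymmetryGroup φ)
    (hfix : scheme.map φ = scheme) :
    ∃ τ ∈ survivors, ∀ T, φ.toLinearEquiv T =
      permMap 3 τ.1 (swAct (matC τ.2.1) (matC τ.2.2.1) (matC τ.2.2.2) T) := by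
  obtain ⟨k, hk, P, Q, R, hP, hQ, hR, hnf⟩ := hφ.exists_normalForm
  have hp := codeOf_mem_gl hP
  have hq := codeOf_mem_gl hQ
  have hr := codeOf_mem_gl hR
  have hnf' : ∀ T, φ.toLinearEquiv T =
      permMap 3 k (swAct (matC (codeOf P)) (matC (codeOf Q)) (matC (codeOf R)) T) := by
    intro T
    rw [hnf T, matC_codeOf, matC_codeOf, matC_codeOf]
    rfl
  refine ⟨(k, codeOf P, codeOf Q, codeOf R), codes_mem_survivors hk hp hq hr fun s => ?_, hnf'⟩
  obtain ⟨s', hs'⟩ := exists_image_term hfix s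
  refine ⟨s', tr3_injective (bd_permC k (bd_sandC _ _ _ _)) (bd_cs s') ?_
    (by rw [tr3_cs]; exact triad_ne_zero s')⟩
  rw [← nf_tr3 k hp hq hr, tr3_cs, tr3_cs, ← hnf', hs']

/-! ## §6 The theorem -/

/-- The map named by a tuple `(k, P, Q, R)` of codes. [cite: HeuleKauersSeidl2021, §4] -/
noncomputable def nfMap (τ : ℕ × ℕ × ℕ × ℕ) (T : Tn (ZMod 2) 3) : Tn (ZMod 2) 3 :=
  permMap 3 τ.1 (swAct (matC τ.2.1) (matC τ.2.2.1) (matC τ.2.2.2) T)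

/-- There are `24` survivors. [cite: Burichenko2015SymI, Thm. 1.1 (`|S₄| = 24`)] -/
theorem survivors_length : survivors.length = 24 := rfl

/-- A fixing element of `G` is `nfMap` of one of the `24` listed tuples. [cite: Burichenko2015SymI, Thm. 1.1] -/
theorem exists_fin_nfMap {φ : Symmetry (matMulTensor (ZMod 2) 3 3 3)} (hφ : InSymmetryGroup φ)
    (hfix : scheme.map φ = scheme) :
    ∃ n : Fin 24, ∀ T, φ.toLinearEquiv T = nfMap (survivors.getD n.val (0, 0, 0, 0)) T := by
  obtain ⟨τ, hτ, h⟩ := mem_survivors hφ hfix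
  obtain ⟨i, hi, e⟩ := List.mem_iff_getElem.mp hτ
  refine ⟨⟨i, survivors_length ▸ hi⟩, fun T => ?_⟩
  rw [List.getD_eq_getElem _ _ hi, e]
  exact h T

/-- Schemes with the same elements are equal. [folklore] -/
private theorem scheme_eq_of_elts_eq {x y : Scheme (matMulTensor (ZMod 2) 3 3 3)}
    (h : x.elts = y.elts) : x = y := by
  cases x; cases y; cases h; rfl

end Exact

/-- **Burichenko 2015, Thm. 1.1, the exactness half over `ℤ₂` (`|Aut(L)| = |S₄| = 24`, no more):**
every element of KM's symmetry group `G` of `⟨3,3,3⟩` over `ℤ₂` that maps Laderman's scheme (mod `2`)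
to itself has the same underlying linear map as one of the `24` elements `LadermanZ2.stab i` of
`LadermanStabilizerZ2.lean`; together with `burichenko2015_laderman_stabilizer` (those `24` are
pairwise distinct, lie in `G` and fix the scheme) the stabiliser has exactly `24` elements as maps.
[cite: Burichenko2015SymI, Thm. 1.1] -/
theorem burichenko2015_laderman_stabilizer_exact {φ : Symmetry (matMulTensor (ZMod 2) 3 3 3)}
    (hφ : InSymmetryGroup φ) (hfix : scheme.map φ = scheme) :
    ∃ i : Fin 24, φ.toLinearEquiv = (stab i).toLinearEquiv := by
  have hst : ∀ i : Fin 24, ∃ n : Fin 24, ∀ T,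
      (stab i).toLinearEquiv T = Exact.nfMap (Exact.survivors.getD n.val (0, 0, 0, 0)) T :=
    fun i => Exact.exists_fin_nfMap (stab_mem_fix i).1 (stab_mem_fix i).2
  choose n hn using hst
  have hinj : Function.Injective n := by
    intro i j hij
    exact stab_injective (LinearEquiv.ext fun T => by rw [hn i, hn j, hij])
  obtain ⟨m, hm⟩ := Exact.exists_fin_nfMap hφ hfix
  obtain ⟨i, hi⟩ := (Finite.injective_iff_surjective.mp hinj) m
  exact ⟨i, LinearEquiv.ext fun T => by rw [hm, hn i, hi]⟩

/-- **Corollary (the stabiliser as a set of maps is the listed one):** an element of `G` fixes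
Laderman's scheme mod `2` iff its linear map is one of the `24` maps `(stab i).toLinearEquiv`.
[cite: Burichenko2015SymI, Thm. 1.1] -/
theorem laderman_stabilizer_iff {φ : Symmetry (matMulTensor (ZMod 2) 3 3 3)} (hφ : InSymmetryGroup φ) :
    scheme.map φ = scheme ↔ ∃ i : Fin 24, φ.toLinearEquiv = (stab i).toLinearEquiv := by
  refine ⟨burichenko2015_laderman_stabilizer_exact hφ, fun ⟨i, hi⟩ => ?_⟩
  have e : scheme.map φ = scheme.map (stab i) :=
    Exact.scheme_eq_of_elts_eq (by rw [Scheme.map_elts, Scheme.map_elts, hi])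
  rw [e]
  exact (stab_mem_fix i).2

end LadermanZ2

end Literature.Computability.AlgebraicComplexity
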